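import Summits.HodgeConjecture.CorCM.StabiliserOrbitSelfConjugateSplitOff
import Summits.HodgeConjecture.CorCM.StabiliserOrbitSelfConjugateCMFields
import Summits.HodgeConjecture.CorCM.PairFlipIsomorphicFieldsFamilies
import HarnessLib

/-!
# MIXED FAMILIES of CM abelian varieties with (SC) fields: up to three per field, fields of different degree or closure —
# `Hg(∏ A_i) = ∏ Hg(A_i)` and the Hodge conjecture on every product

COR-CM (cell `pub-hodgecm2`, binder seat `b16` gen 54, count-neutral claim STAB-CONJ, file F8; theorems only, no definition,
no named fact, no `sorry`).  NEW as stated, hence under `Summits/`.  HONEST FRAMING: unconditional theorems on products of CM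
abelian varieties of arbitrary dimensions; `HC_CM` is neither used nor advanced — «HC for a NAMED class».

F2 (`…CMFields`): up to THREE pairwise non-isogenous varieties with CM by ONE (SC) field are additive.  F6 (`…SplitOff`): (SC)
slots of pairwise different degree or different Galois closure share no constituent.  Gen 43's transport
(`PairFlipIsomorphicFieldsFamilies.isNondegenerateFamily_iff_cmTypeMap`) moves types along field isomorphisms, and its block
criterion (`isNondegenerateFamily_of_fibers`) assembles blocks.  Together:

* §1 **`isNondegenerateFamily_of_ringEquiv_of_stabConj_of_card_le_three`** — at most three pairwise non-isogenous CM
  abelian varieties whose CM fields are ISOMORPHIC to one (SC) field `K₀`: nondegenerate family; `hodgeConjectureFor_prod_…`;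
  `not_isNondegenerateFamily_of_ringEquiv_of_lt_card` is gen 43's (any `K₀`).
* §2 **`isNondegenerateFamily_stabConj_mixed`** — THE MIXED FAMILY THEOREM.  A finite family of CM abelian varieties `A_i`
  realising types `Φ_i` of (SC) fields `K_i`, with a labelling `κ : I → C₀` such that (a) equal labels ⟹ isomorphic
  fields, (b) different labels ⟹ different degree or different Galois closure, (c) at most three slots per label, pairwise
  non-isogenous: then `(Φ_i)_i` is nondegenerate — `Hg(∏ A_i) = ∏ Hg(A_i)`.  E.g. `E × E′ × S₁ × S₂ × T × F₁ × F₂ × F₃` with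
  `E, E′` elliptic curves with CM by different imaginary quadratic fields, `S₁ ≁ S₂` simple surfaces with one non-Galois
  quartic field, `T` a generic threefold, `F₁, F₂, F₃` pairwise non-isogenous fourfolds with one `GL₂(𝔽₃)`- or
  `W(D₄)`-octic field (given (SC) for it).  **`hodgeConjectureFor_prod_stabConj_mixed`** — the Hodge conjecture with
  `B• = D•` on every `⨁_{j<N} A_{π j}`, UNCONDITIONALLY; `not_exists_exceptional_prod_stabConj_mixed`.

This contains Gordon's theorem on products of elliptic curves (all fields imaginary quadratic: (SC) is vacuous, closures
differ) and this seat's gen-43/44 generic statements, with pair flips weakened to (SC).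

## References

* [Gordon1999HodgeAVSurvey] B. B. Gordon, *A survey of the Hodge conjecture for abelian varieties*, §3 Theorem (Imai,
  Murty), 7.4–7.7, 10.10.
* [Dodson1984] B. Dodson, *The structure of Galois groups of CM-fields*, Trans. AMS 283 (1984), §1.1, §5.1.2.
* [Shimura1998] G. Shimura, *Abelian Varieties with Complex Multiplication and Modular Functions*, §32.7.
-/

set_option autoImplicit false

noncomputable section

open CategoryTheory CategoryTheory.Limits NumberField Module IntermediateField

namespace Summit.HodgeConjecture.CorCM

open Literature.NumberTheory.ComplexMultiplication
open Literature.AlgebraicGeometry.Motives (AbelianVariety CMType)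
open Literature.AlgebraicGeometry.HodgeTheory
open Literature.AlgebraicGeometry.ComplexMultiplication (IsCMTypeRealisation)
open Literature.AlgebraicGeometry.VanGeemen1994 (hodgeClassSpan)
open Literature.AlgebraicGeometry.Pohlmann1968
open Literature.Barriers.HodgeConjecture (divisorClassesSpan)

/-! ## §1 Fields isomorphic to one (SC) field -/

section Isomorphic

variable {J : Type} {K : J → Type} [∀ j, Field (K j)] [∀ j, NumberField (K j)] [∀ j, IsCMField (K j)]
  {K₀ : Type} [Field K₀] [NumberField K₀] [IsCMField K₀]
  [Fintype J] [Nonempty J] {Φ : ∀ j, CMType (K j)} {A : J → AbelianVariety ℂ} {ι : ∀ j, 𝓞 (K j) →+* End (A j)}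
  {θ : ∀ j, K j →+* Module.End ℂ (complexBetti (A j).X 1)}

omit [∀ j, IsCMField (K j)] in
/-- **At most three pairwise non-isogenous CM abelian varieties whose CM fields are isomorphic to ONE (SC) field `K₀`:
the family of their types is nondegenerate** (`Hg(∏ A_j) = ∏ Hg(A_j)`; F2 transported along `e_j : K_j ≃ K₀`).
[cite: Gordon1999HodgeAVSurvey, §3 Theorem and 7.5] [cite: Shimura1998, §32.7] -/
theorem isNondegenerateFamily_of_ringEquiv_of_stabConj_of_card_le_three (e : ∀ j, K j ≃+* K₀)
    (hSC : ∀ x₀ x : K₀ →+* ℂ, x ≠ x₀ → x ≠ (starRingAut : ℂ ≃+* ℂ) • x₀ →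
      ∃ σ : ℂ ≃+* ℂ, σ • x₀ = x₀ ∧ σ • x = (starRingAut : ℂ ≃+* ℂ) • x)
    (hA : ∀ j, IsCMTypeRealisation (Φ j) (A j) (ι j) (θ j))
    (hniso : ∀ i j, i ≠ j → ¬ AbelianVariety.IsIsogenous (A i) (A j)) (hcard : Fintype.card J ≤ 3) :
    CMAlgebra.IsNondegenerateFamily Φ := by
  rw [isNondegenerateFamily_iff_cmTypeMap e]
  exact isNondegenerateFamily_of_card_le_three_of_stabConj hSC (fun j => (hA j).transport (e j)) hniso hcard

/-- **The Hodge conjecture on every product** of at most three pairwise non-isogenous CM abelian varieties whose CM fields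
are isomorphic to one (SC) field, with `B• = D•`, UNCONDITIONALLY. [cite: Gordon1999HodgeAVSurvey, 7.5 and 10.10] -/
theorem hodgeConjectureFor_prod_of_ringEquiv_of_stabConj_of_card_le_three (e : ∀ j, K j ≃+* K₀)
    (hSC : ∀ x₀ x : K₀ →+* ℂ, x ≠ x₀ → x ≠ (starRingAut : ℂ ≃+* ℂ) • x₀ →
      ∃ σ : ℂ ≃+* ℂ, σ • x₀ = x₀ ∧ σ • x = (starRingAut : ℂ ≃+* ℂ) • x)
    (hA : ∀ j, IsCMTypeRealisation (Φ j) (A j) (ι j) (θ j))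
    (hniso : ∀ i j, i ≠ j → ¬ AbelianVariety.IsIsogenous (A i) (A j)) (hcard : Fintype.card J ≤ 3)
    {N : ℕ} (π : Fin N → J) :
    HodgeConjectureFor (⨁ fun j : Fin N => A (π j)).dim (⨁ fun j : Fin N => A (π j)).X ∧
      ∀ m : ℕ, hodgeClassSpan (⨁ fun j : Fin N => A (π j)).dim (⨁ fun j : Fin N => A (π j)).X m =
        divisorClassesSpan (⨁ fun j : Fin N => A (π j)).X (⨁ fun j : Fin N => A (π j)).dim m :=
  have h := isNondegenerateFamily_of_ringEquiv_of_stabConj_of_card_le_three e hSC hA hniso hcard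
  ⟨h.hodgeConjectureFor_prod hA π, fun m => h.hodgeClassSpan_prod_eq_divisorClassesSpan hA π m⟩

end Isomorphic

/-! ## §2 The mixed family theorem -/

section Mixed

variable {I : Type} {K : I → Type} [∀ i, Field (K i)] [∀ i, NumberField (K i)] [∀ i, IsCMField (K i)]
  [Fintype I] [Nonempty I] {Φ : ∀ i, CMType (K i)} {A : I → AbelianVariety ℂ}
  {ι : ∀ i, 𝓞 (K i) →+* End (A i)} {θ : ∀ i, K i →+* Module.End ℂ (complexBetti (A i).X 1)}

/-- **THE MIXED FAMILY THEOREM for (SC) fields.**  Every `K_i` is (SC); `κ : I → C₀` labels the slots so that (a) slots with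
the same label have isomorphic fields, (b) slots with different labels have fields of different degree or different Galois
closure, (c) each label carries at most three slots, realised by pairwise non-isogenous abelian varieties.  Then the family
`(Φ_i)_i` is nondegenerate: `Hg(∏ A_i) = ∏ Hg(A_i)` (blocks = labels: each block is F2/§1, different blocks share no
constituent by F6). [cite: Gordon1999HodgeAVSurvey, §3 Theorem, 7.5–7.7] [cite: Dodson1984, §5.1.2] -/
theorem isNondegenerateFamily_stabConj_mixed {C₀ : Type} [DecidableEq C₀] (κ : I → C₀)
    (hSC : ∀ i, ∀ x₀ x : K i →+* ℂ, x ≠ x₀ → x ≠ (starRingAut : ℂ ≃+* ℂ) • x₀ →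
      ∃ σ : ℂ ≃+* ℂ, σ • x₀ = x₀ ∧ σ • x = (starRingAut : ℂ ≃+* ℂ) • x)
    (hiso : ∀ i j, κ i = κ j → Nonempty (K i ≃+* K j))
    (hsep : ∀ i j, κ i ≠ κ j →
      finrank ℚ (K i) ≠ finrank ℚ (K j) ∨ normalClosure ℚ (K i) ℂ ≠ normalClosure ℚ (K j) ℂ)
    (hA : ∀ i, IsCMTypeRealisation (Φ i) (A i) (ι i) (θ i))
    (hniso : ∀ i j, i ≠ j → κ i = κ j → ¬ AbelianVariety.IsIsogenous (A i) (A j))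
    (hcard : ∀ c, Fintype.card {i // κ i = c} ≤ 3) :
    CMAlgebra.IsNondegenerateFamily Φ := by
  classical
  refine isNondegenerateFamily_of_fibers Φ κ (fun i j hij => ?_) (fun c hc => ?_)
  · exact (pairwise_stabConj_stabConj (Φ := Φ) (hSC i) (hSC j) (hsep i j hij)).1
  · obtain ⟨i₀, hi₀⟩ := hc
    haveI : Nonempty {i // κ i = c} := ⟨⟨i₀, hi₀⟩⟩
    let e : ∀ i : {i // κ i = c}, K i.1 ≃+* K i₀ := fun i => Classical.choice (hiso i.1 i₀ (i.2.trans hi₀.symm))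
    exact isNondegenerateFamily_of_ringEquiv_of_stabConj_of_card_le_three (K := fun i : {i // κ i = c} => K i.1)
      (Φ := fun i => Φ i.1) e (hSC i₀) (fun i => hA i.1)
      (fun i j hij => hniso i.1 j.1 (fun h => hij (Subtype.ext h)) (i.2.trans j.2.symm)) (hcard c)

/-- **The Hodge conjecture on every `⨁_{j<N} A_{π j}`** (every `∏ A_i^{k_i}`), with `B• = D•` there, for a mixed family of CM
abelian varieties with (SC) fields as in `isNondegenerateFamily_stabConj_mixed` — UNCONDITIONALLY.
[cite: Gordon1999HodgeAVSurvey, §3 Theorem, 7.5 and 10.10] -/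
theorem hodgeConjectureFor_prod_stabConj_mixed {C₀ : Type} [DecidableEq C₀] (κ : I → C₀)
    (hSC : ∀ i, ∀ x₀ x : K i →+* ℂ, x ≠ x₀ → x ≠ (starRingAut : ℂ ≃+* ℂ) • x₀ →
      ∃ σ : ℂ ≃+* ℂ, σ • x₀ = x₀ ∧ σ • x = (starRingAut : ℂ ≃+* ℂ) • x)
    (hiso : ∀ i j, κ i = κ j → Nonempty (K i ≃+* K j))
    (hsep : ∀ i j, κ i ≠ κ j →
      finrank ℚ (K i) ≠ finrank ℚ (K j) ∨ normalClosure ℚ (K i) ℂ ≠ normalClosure ℚ (K j) ℂ)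
    (hA : ∀ i, IsCMTypeRealisation (Φ i) (A i) (ι i) (θ i))
    (hniso : ∀ i j, i ≠ j → κ i = κ j → ¬ AbelianVariety.IsIsogenous (A i) (A j))
    (hcard : ∀ c, Fintype.card {i // κ i = c} ≤ 3) {N : ℕ} (π : Fin N → I) :
    HodgeConjectureFor (⨁ fun j : Fin N => A (π j)).dim (⨁ fun j : Fin N => A (π j)).X ∧
      ∀ m : ℕ, hodgeClassSpan (⨁ fun j : Fin N => A (π j)).dim (⨁ fun j : Fin N => A (π j)).X m =
        divisorClassesSpan (⨁ fun j : Fin N => A (π j)).X (⨁ fun j : Fin N => A (π j)).dim m :=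
  have h := isNondegenerateFamily_stabConj_mixed (Φ := Φ) κ hSC hiso hsep hA hniso hcard
  ⟨h.hodgeConjectureFor_prod hA π, fun m => h.hodgeClassSpan_prod_eq_divisorClassesSpan hA π m⟩

/-- **No product carries an exceptional Hodge class** in the situation of `isNondegenerateFamily_stabConj_mixed`.
[cite: Gordon1999HodgeAVSurvey, 7.5 and 7.6.1] -/
theorem not_exists_exceptional_prod_stabConj_mixed {C₀ : Type} [DecidableEq C₀] (κ : I → C₀)
    (hSC : ∀ i, ∀ x₀ x : K i →+* ℂ, x ≠ x₀ → x ≠ (starRingAut : ℂ ≃+* ℂ) • x₀ →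
      ∃ σ : ℂ ≃+* ℂ, σ • x₀ = x₀ ∧ σ • x = (starRingAut : ℂ ≃+* ℂ) • x)
    (hiso : ∀ i j, κ i = κ j → Nonempty (K i ≃+* K j))
    (hsep : ∀ i j, κ i ≠ κ j →
      finrank ℚ (K i) ≠ finrank ℚ (K j) ∨ normalClosure ℚ (K i) ℂ ≠ normalClosure ℚ (K j) ℂ)
    (hA : ∀ i, IsCMTypeRealisation (Φ i) (A i) (ι i) (θ i))
    (hniso : ∀ i j, i ≠ j → κ i = κ j → ¬ AbelianVariety.IsIsogenous (A i) (A j))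
    (hcard : ∀ c, Fintype.card {i // κ i = c} ≤ 3) {N : ℕ} (π : Fin N → I) (m : ℕ) :
    ¬∃ c : complexBetti (⨁ fun j : Fin N => A (π j)).X (2 * m), IsRationalClass c ∧
        IsOfHodgeType (⨁ fun j : Fin N => A (π j)).dim (⨁ fun j : Fin N => A (π j)).X (2 * m) m m c ∧
        c ∉ divisorClassesSpan (⨁ fun j : Fin N => A (π j)).X (⨁ fun j : Fin N => A (π j)).dim m :=
  (isNondegenerateFamily_stabConj_mixed (Φ := Φ) κ hSC hiso hsep hA hniso hcard).not_exists_exceptional_prod hA π m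

/-- **Label by the field's isomorphism class given as data**: the same with `κ` replaced by any map such that equal labels
mean isomorphic fields and distinct labels mean fields of DIFFERENT DEGREE — e.g. `κ i = [K_i : ℚ]` when all fields of
equal degree in the family are isomorphic: CM abelian varieties of pairwise distinct dimensions, up to three non-isogenous
ones per dimension sharing one (SC) field. [cite: Gordon1999HodgeAVSurvey, §3 Theorem, 7.5 and 10.10] -/
theorem hodgeConjectureFor_prod_stabConj_mixed_of_finrank
    (hSC : ∀ i, ∀ x₀ x : K i →+* ℂ, x ≠ x₀ → x ≠ (starRingAut : ℂ ≃+* ℂ) • x₀ →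
      ∃ σ : ℂ ≃+* ℂ, σ • x₀ = x₀ ∧ σ • x = (starRingAut : ℂ ≃+* ℂ) • x)
    (hiso : ∀ i j, finrank ℚ (K i) = finrank ℚ (K j) → Nonempty (K i ≃+* K j))
    (hA : ∀ i, IsCMTypeRealisation (Φ i) (A i) (ι i) (θ i))
    (hniso : ∀ i j, i ≠ j → finrank ℚ (K i) = finrank ℚ (K j) → ¬ AbelianVariety.IsIsogenous (A i) (A j))
    (hcard : ∀ d : ℕ, Fintype.card {i // finrank ℚ (K i) = d} ≤ 3) {N : ℕ} (π : Fin N → I) :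
    HodgeConjectureFor (⨁ fun j : Fin N => A (π j)).dim (⨁ fun j : Fin N => A (π j)).X ∧
      ∀ m : ℕ, hodgeClassSpan (⨁ fun j : Fin N => A (π j)).dim (⨁ fun j : Fin N => A (π j)).X m =
        divisorClassesSpan (⨁ fun j : Fin N => A (π j)).X (⨁ fun j : Fin N => A (π j)).dim m :=
  hodgeConjectureFor_prod_stabConj_mixed (Φ := Φ) (fun i => finrank ℚ (K i)) hSC hiso (fun _ _ h => Or.inl h) hA hniso
    hcard π

end Mixed

end Summit.HodgeConjecture.CorCM

end
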